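import Literature.AlgebraicGeometry.Resolution.RegularCentreLocal
import Literature.AlgebraicGeometry.Resolution.RegularParameterQuotient
import Mathlib.RingTheory.Ideal.Height
import HarnessLib

/-!
# A regular centre is locally cut out by a quasi-regular sequence of length its codimension

Topic: `Literature/AlgebraicGeometry/Resolution`. PROVED refinement of the local structure
theorem `exists_isQuasiRegular_away_of_isRegularRing` (`RegularCentreLocal.lean`; Liu, Thm. 8.1.19,
reduction to the affine case; Matsumura Thm. 14.2): for a regular ring `A`, an ideal `I` with
`A/I` regular and a prime `p ⊇ I`, there are `g ∉ p` and `f_1, …, f_c ∈ I` cutting out `V(I)`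
over `D(g)` by a quasi-regular sequence with regular quotient — AND the length `c` of the
sequence is the codimension of the centre at `p`: `ht p = ht (p/I) + c` (the `f_i` have linearly
independent differentials in the regular local ring `A_p`, so `A_p/(f)` is regular of dimension
`dim A_p − c`, Matsumura Thm. 14.2). This is what identifies the rank `c − 1` of the projective
bundle `E ≅ ℙ(𝓘/𝓘²)` over the centre (Liu 8.1.19 (b): "of rank `codim(Y, X) − 1`").

* `forall_mem_maximalIdeal_of_linearIndependent_toCotangent` — independence in `𝔪/𝔪²` in its
  ring-level form `∑ αᵢ fᵢ ∈ 𝔪² ⇒ αᵢ ∈ 𝔪`;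
* `height_map_quotient_mk_add_eq_height` — `ht (p/J) + c = ht p` when `J A_p` is generated by
  `c` elements with independent differentials;
* `exists_isQuasiRegular_away_of_isRegularRing_codim` — **the local structure theorem with the
  codimension**.

## Sources

* Q. Liu, *Algebraic Geometry and Arithmetic Curves*, OUP 2002, Thm. 8.1.19 and Exercise 8.1.4.
  [Liu2002]
* H. Matsumura, *Commutative Ring Theory*, CUP 1986, Thm. 14.2, Thm. 16.2. [Matsumura1987]
-/
noncomputable section

open IsLocalRing

namespace Literature.AlgebraicGeometry.Resolution

universe u

/-! ## Independence of differentials, ring-level form -/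

/-- Linear independence of `df_1, …, df_c` in `𝔪/𝔪²` in its ring-level form: if
`∑ αᵢ fᵢ ∈ 𝔪²` then every `αᵢ ∈ 𝔪`. [folklore] -/
theorem forall_mem_maximalIdeal_of_linearIndependent_toCotangent {R : Type u} [CommRing R]
    [IsLocalRing R] {c : ℕ} (f : Fin c → R) (hf : ∀ i, f i ∈ maximalIdeal R)
    (hli : LinearIndependent (ResidueField R) fun i => (maximalIdeal R).toCotangent ⟨f i, hf i⟩)
    (α : Fin c → R) (hα : ∑ i, α i * f i ∈ maximalIdeal R ^ 2) : ∀ i, α i ∈ maximalIdeal R := by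
  intro i
  have hsum : (maximalIdeal R).toCotangent (∑ j, α j • (⟨f j, hf j⟩ : maximalIdeal R)) = 0 := by
    rw [Ideal.toCotangent_eq_zero]
    have hcoe : (((∑ j, α j • (⟨f j, hf j⟩ : maximalIdeal R)) : maximalIdeal R) : R) =
        ∑ j, α j * f j := by
      rw [AddSubmonoidClass.coe_finsetSum]
      exact Finset.sum_congr rfl fun j _ => rfl
    rw [hcoe]
    exact hα
  rw [map_sum] at hsum
  have hsum' : (∑ j, residue R (α j) • (maximalIdeal R).toCotangent ⟨f j, hf j⟩) = 0 := by
    rw [← hsum]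
    refine Finset.sum_congr rfl fun j _ => ?_
    rw [LinearMap.map_smul_of_tower]
    rfl
  have := Fintype.linearIndependent_iff.mp hli (fun j => residue R (α j)) hsum' i
  exact (residue_eq_zero_iff _).mp this

/-! ## Heights: `ht p = ht (p/J) + c` -/

/-- **Codimension of a centre generated by independent differentials.** Let `A` be a ring,
`p` a prime, `I ≤ p` an ideal, and suppose `I A_p = (f_1, …, f_c)` with `f_i ∈ 𝔪_{A_p}` having
linearly independent images in `𝔪/𝔪²` of the regular local ring `A_p`. Then
`ht (p/I) + c = ht p` (`A_p/(f)` is regular local of dimension `dim A_p − c`, Matsumura 14.2, and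
`A_p / I A_p = (A/I)_{p/I}`). [cite: Matsumura1987, Thm. 14.2] -/
theorem height_map_quotient_mk_add_eq_height {A : Type u} [CommRing A] (I : Ideal A)
    (p : Ideal A) [hp : p.IsPrime] (hIp : I ≤ p) [IsRegularLocalRing (Localization.AtPrime p)]
    {c : ℕ} (f : Fin c → Localization.AtPrime p)
    (hf : ∀ i, f i ∈ maximalIdeal (Localization.AtPrime p))
    (hli : LinearIndependent (ResidueField (Localization.AtPrime p))
      fun i => (maximalIdeal (Localization.AtPrime p)).toCotangent ⟨f i, hf i⟩)
    (hspan : Ideal.span (Set.range f) = I.map (algebraMap A (Localization.AtPrime p))) :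
    (p.map (Ideal.Quotient.mk I)).height + c = p.height := by
  -- `A_p/(f)` is regular of dimension `dim A_p - c`
  have hdim := (RegularParameters.isRegularLocalRing_quotient_span_range f hf
    (forall_mem_maximalIdeal_of_linearIndependent_toCotangent f hf hli)).2
  rw [hspan] at hdim
  -- `A_p / I A_p` is the localisation of `A/I` at `p/I`
  set pbar : Ideal (A ⧸ I) := p.map (Ideal.Quotient.mk I) with hpbar
  have hcomap : pbar.comap (Ideal.Quotient.mk I) = p := by
    rw [hpbar, Ideal.comap_map_of_surjective _ Ideal.Quotient.mk_surjective,
      ← RingHom.ker_eq_comap_bot, Ideal.mk_ker, sup_eq_left]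
    exact hIp
  haveI hpbarp : pbar.IsPrime :=
    Ideal.map_isPrime_of_surjective Ideal.Quotient.mk_surjective (by rwa [Ideal.mk_ker])
  have hmem : ∀ a : A, Ideal.Quotient.mk I a ∈ pbar ↔ a ∈ p := fun a => by
    rw [← Ideal.mem_comap, hcomap]
  have hM : Algebra.algebraMapSubmonoid (A ⧸ I) p.primeCompl = pbar.primeCompl := by
    ext b
    constructor
    · rintro ⟨a, ha, rfl⟩
      exact fun h => ha ((hmem a).mp h)
    · intro hb
      obtain ⟨a, rfl⟩ := Ideal.Quotient.mk_surjective b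
      exact ⟨a, fun h => hb ((hmem a).mpr h), rfl⟩
  haveI : IsLocalization.AtPrime
      (Localization.AtPrime p ⧸ I.map (algebraMap A (Localization.AtPrime p))) pbar := by
    have := (inferInstance : IsLocalization (Algebra.algebraMapSubmonoid (A ⧸ I) p.primeCompl)
      (Localization.AtPrime p ⧸ I.map (algebraMap A (Localization.AtPrime p))))
    rwa [hM] at this
  rw [IsLocalization.AtPrime.ringKrullDim_eq_height pbar
      (Localization.AtPrime p ⧸ I.map (algebraMap A (Localization.AtPrime p))),
    IsLocalization.AtPrime.ringKrullDim_eq_height p (Localization.AtPrime p)] at hdim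
  exact_mod_cast hdim

/-! ## The local structure theorem with the codimension -/

/-- **Local structure of a regular centre in a regular ring, with its codimension**: let `A` be
a regular ring, `I` an ideal with `A/I` a regular ring, and `p ⊇ I` a prime. Then there are
`g ∉ p` and `f_1, …, f_c ∈ I` with `ht (p/I) + c = ht p` such that in `A[1/g]` (any
localisation away from `g`): `I A[1/g] = (f)`, `f` is quasi-regular, and `A[1/g]`,
`A[1/g]/(f)` are regular rings. Proof: in the regular local ring `A_p` the ideal `I A_p` (with
regular quotient) is generated by elements `f_i ∈ I` with independent differentials
(`RegularQuotientIdeal.lean`), an `A_p`-sequence of length `c = dim A_p − dim A_p/I A_p`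
(Matsumura 14.2); spread the generation of `I` and the regularity of the sequence from `A_p`
to some `A[1/g]` (`RegularCentreLocal.lean`).
[cite: Liu2002, Thm. 8.1.19 (a) (reduction to the affine case)] [cite: Matsumura1987, Thm. 14.2] -/
theorem exists_isQuasiRegular_away_of_isRegularRing_codim {A : Type u} [CommRing A]
    [IsRegularRing A] (I : Ideal A) [IsRegularRing (A ⧸ I)] (p : Ideal A) [hp : p.IsPrime]
    (hIp : I ≤ p) :
    ∃ g : A, g ∉ p ∧ ∃ (c : ℕ) (f : Fin c → A), (∀ i, f i ∈ I) ∧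
      (p.map (Ideal.Quotient.mk I)).height + c = p.height ∧
      ∀ (L : Type u) [CommRing L] [Algebra A L] [IsLocalization.Away g L],
        Ideal.map (algebraMap A L) I = Ideal.span (Set.range (algebraMap A L ∘ f)) ∧
        IsQuasiRegular (algebraMap A L ∘ f) ∧ IsRegularRing L ∧
        IsRegularRing (L ⧸ Ideal.map (algebraMap A L) I) := by
  classical
  -- the regular local ring `A_p` and the ideal `J = I A_p` with regular quotient
  haveI : IsRegularLocalRing (Localization.AtPrime p) := inferInstance
  have hJm : I.map (algebraMap A (Localization.AtPrime p)) ≤ maximalIdeal (Localization.AtPrime p) := by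
    rw [← Localization.AtPrime.map_eq_maximalIdeal]
    exact Ideal.map_mono hIp
  haveI := isRegularLocalRing_localization_quotient_of_le I p hIp
  have hG : Ideal.span (algebraMap A (Localization.AtPrime p) '' (I : Set A)) =
      I.map (algebraMap A (Localization.AtPrime p)) := rfl
  obtain ⟨c, f', hf'G, hspan', hli⟩ :=
    exists_span_eq_of_isRegularLocalRing_quotient hJm _ hG
  have hf'm : ∀ i, f' i ∈ maximalIdeal (Localization.AtPrime p) := fun i =>
    hJm (hspan' ▸ Ideal.subset_span ⟨i, rfl⟩)
  have hcolon' : ∀ (i : Fin c) (T : Set (Fin c)), i ∉ T → ∀ y : Localization.AtPrime p,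
      f' i * y ∈ Ideal.span (f' '' T) → y ∈ Ideal.span (f' '' T) := fun i T hiT y hy =>
    mem_span_image_of_mul_mem_of_linearIndependent_toCotangent f' hf'm hli i T hiT y hy
  -- the codimension
  have hheight : (p.map (Ideal.Quotient.mk I)).height + c = p.height :=
    height_map_quotient_mk_add_eq_height I p hIp f' hf'm hli hspan'
  -- preimages `f_i ∈ I`
  have hpre : ∀ i, ∃ a : A, a ∈ I ∧ algebraMap A (Localization.AtPrime p) a = f' i := fun i => by
    obtain ⟨a, ha, h⟩ := hf'G i
    exact ⟨a, ha, h⟩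
  choose f hfI hff' using hpre
  have hrange : Set.range f' = Set.range (algebraMap A (Localization.AtPrime p) ∘ f) := by
    ext z
    simp only [Set.mem_range, Function.comp_apply, hff']
  have himg : ∀ i : Fin c, Ideal.span (f' '' Set.Iio i) =
      (Ideal.span (f '' Set.Iio i)).map (algebraMap A (Localization.AtPrime p)) := fun i => by
    rw [Ideal.map_span, Set.image_image]
    congr 1
    ext z
    simp only [Set.mem_image, hff']
  -- `f` is an `A_p`-sequence, in colon form over `A`
  have hreg : ∀ (i : Fin c) (y : A), f i * y ∈ Ideal.span (f '' Set.Iio i) →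
      ∃ s : A, s ∉ p ∧ s * y ∈ Ideal.span (f '' Set.Iio i) := by
    intro i y hy
    have h1 : f' i * algebraMap A (Localization.AtPrime p) y ∈ Ideal.span (f' '' Set.Iio i) := by
      rw [himg, ← hff', ← map_mul]
      exact Ideal.mem_map_of_mem _ hy
    have h2 := hcolon' i (Set.Iio i) (fun h => lt_irrefl i h) _ h1
    rw [himg, IsLocalization.algebraMap_mem_map_algebraMap_iff p.primeCompl] at h2
    obtain ⟨s, hs, hsy⟩ := h2
    exact ⟨s, hs, hsy⟩
  obtain ⟨g₁, hg₁p, hg₁⟩ := exists_uniform_multiplier_of_regular_at_prime f p hreg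
  -- the generators of `I` lie in `(f) A_p`: clear denominators
  obtain ⟨gens, hgens⟩ := (IsNoetherian.noetherian I : I.FG)
  have hgen1 : ∀ x : A, x ∈ gens → ∃ t : A, t ∉ p ∧ t * x ∈ Ideal.span (Set.range f) := by
    intro x hx
    have hxI : x ∈ I := hgens ▸ Submodule.subset_span hx
    have h1 : algebraMap A (Localization.AtPrime p) x ∈ Ideal.span (Set.range f') := by
      rw [hspan']
      exact Ideal.mem_map_of_mem _ hxI
    rw [hrange, Set.range_comp, ← Ideal.map_span,
      IsLocalization.algebraMap_mem_map_algebraMap_iff p.primeCompl] at h1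
    obtain ⟨t, ht, htx⟩ := h1
    exact ⟨t, ht, htx⟩
  choose! t ht using hgen1
  have hg₀p : (∏ x ∈ gens, t x) ∉ p := by
    intro hmem
    obtain ⟨x, hx, htx⟩ := (hp.prod_mem_iff).mp hmem
    exact (ht x hx).1 htx
  refine ⟨(∏ x ∈ gens, t x) * g₁, fun h => (hp.mem_or_mem h).elim hg₀p hg₁p, c, f, hfI, hheight, ?_⟩
  intro L _ _ _
  have hunit : ∀ x : A, x ∈ gens → IsUnit (algebraMap A L (t x)) := by
    intro x hx
    have hu : IsUnit (algebraMap A L ((∏ x ∈ gens, t x) * g₁)) :=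
      IsLocalization.Away.algebraMap_isUnit _
    obtain ⟨r, hr⟩ : t x ∣ (∏ x ∈ gens, t x) * g₁ := (Finset.dvd_prod_of_mem t hx).mul_right g₁
    rw [hr, map_mul] at hu
    exact isUnit_of_mul_isUnit_left hu
  -- (a) `I A[1/g] = (f)`
  have hIL : I.map (algebraMap A L) = Ideal.span (Set.range (algebraMap A L ∘ f)) := by
    apply le_antisymm
    · rw [← hgens, Ideal.map_span, Ideal.span_le]
      rintro _ ⟨x, hx, rfl⟩
      have hx' : x ∈ gens := hx
      have hmem : algebraMap A L (t x * x) ∈ Ideal.span (Set.range (algebraMap A L ∘ f)) := by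
        rw [Set.range_comp, ← Ideal.map_span]
        exact Ideal.mem_map_of_mem _ (ht x hx').2
      rw [map_mul] at hmem
      exact (Ideal.unit_mul_mem_iff_mem _ (hunit x hx')).mp hmem
    · rw [Ideal.span_le]
      rintro _ ⟨i, rfl⟩
      exact Ideal.mem_map_of_mem _ (hfI i)
  -- (b) quasi-regular in `A[1/g]`
  have hg : ∀ (i : Fin c) (y : A), f i * y ∈ Ideal.span (f '' Set.Iio i) →
      (∏ x ∈ gens, t x) * g₁ * y ∈ Ideal.span (f '' Set.Iio i) := fun i y hy => by
    rw [mul_assoc]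
    exact Ideal.mul_mem_left _ _ (hg₁ i y hy)
  have hqr : IsQuasiRegular (algebraMap A L ∘ f) :=
    isQuasiRegular_of_regularSeq c _ fun i z hz => regularSeq_map_of_uniform_multiplier f hg L i z hz
  -- (c), (d) regularity of `A[1/g]` and of `A[1/g] / I A[1/g]`, localisations of `A` and `A/I`
  haveI hL : IsRegularRing L := isRegularRing_of_isLocalization (Submonoid.powers ((∏ x ∈ gens, t x) * g₁)) L
  have hLq : IsRegularRing (L ⧸ I.map (algebraMap A L)) :=
    isRegularRing_of_isLocalization
      (Algebra.algebraMapSubmonoid (A ⧸ I) (Submonoid.powers ((∏ x ∈ gens, t x) * g₁)))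
      (L ⧸ I.map (algebraMap A L))
  exact ⟨hIL, hqr, hL, hLq⟩

end Literature.AlgebraicGeometry.Resolution

end
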